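import Mathlib.NumberTheory.ArithmeticFunction.Liouville
import Mathlib.NumberTheory.DirichletCharacter.Basic
import Mathlib.NumberTheory.DirichletCharacter.Bounds
import Mathlib.Data.ZMod.Basic
import Mathlib.Data.Nat.ModEq
import Mathlib.Analysis.Complex.Basic
import HarnessLib

/-!
# Main terms of the line `peel-to-drappeau` (crux `TypeI2Dilated`) — expanding the twist over classes

In the main-term estimate of the line `peel-to-drappeau` a class sum of the Liouville function twisted by a
Dirichlet character `ψ mod f`,

`G = ‖∑_{1 ≤ t ≤ M, d t ≡ e (mod L)} λ(t) ψ(t)‖`  (`d` a unit mod `L`, `(f, L) = 1`),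

has to be fed to a Bombieri–Vinogradov-type family bound which only accepts PLAIN class sums
`|∑_{t ≤ M, t ≡ z (mod m)} λ(t)|` (real absolute value).  The theorem `norm_classSum_char_le_sum_classes`
of this file performs this reduction:

`G ≤ ∑_{b < f} |∑_{1 ≤ t ≤ M, t ≡ z_b (mod L f)} λ(t)|`

for explicit classes `z_b` (independent of `M`).  Proof: split `t` according to `b = t % f`; on the fibre
`ψ(t) = ψ(b)` has norm `≤ 1` (`DirichletCharacter.norm_le_one`), so the fibre contributes at most
`‖∑ λ(t)‖ = |∑ λ(t)|`.  The fibre `{d t ≡ e (L)} ∩ {t ≡ b (f)}` is one class modulo `L f`: `d` is invertible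
mod `L`, so `d t ≡ e (L) ↔ t ≡ a (L)` with `a = e d⁻¹` (`MainTermsAux.natCast_mul_eq_iff`), and the Chinese
remainder theorem for the coprime moduli `L`, `f` (`Nat.chineseRemainder`,
`Nat.modEq_and_modEq_iff_modEq_mul`) merges `t ≡ a (L)`, `t ≡ b (f)` into `t ≡ z_b (L f)`
(`MainTermsAux.natCast_eq_crt_iff`).
[this line: Lines/peel-to-drappeau.md]
-/

noncomputable section

namespace Summit.Parity.GeneralizedHardyLittlewood.Cruxes.TypeI2Dilated.PeelToDrappeau

namespace MainTermsAux

open Finset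
open scoped Classical
open ArithmeticFunction (liouville)

/-! ### The two congruences -/

/-- For `d` a unit mod `L` the congruence `d t ≡ e (mod L)` is the class `t ≡ e d⁻¹ (mod L)`; the class is
written through its representative `(e d⁻¹).val : ℕ`. [folklore] -/
theorem natCast_mul_eq_iff {L : ℕ} [NeZero L] {d : ℕ} (hd : d.Coprime L) (e : ZMod L) (t : ℕ) :
    ((d * t : ℕ) : ZMod L) = e ↔ (t : ZMod L) = (((e * (d : ZMod L)⁻¹).val : ℕ) : ZMod L) := by
  have hu : IsUnit (d : ZMod L) := (ZMod.isUnit_iff_coprime d L).2 hd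
  rw [ZMod.natCast_zmod_val, Nat.cast_mul]
  constructor
  · intro h
    calc (t : ZMod L) = (d : ZMod L)⁻¹ * ((d : ZMod L) * (t : ZMod L)) := by
          rw [← mul_assoc, ZMod.inv_mul_of_unit _ hu, one_mul]
      _ = e * (d : ZMod L)⁻¹ := by rw [h, mul_comm]
  · intro h
    rw [h, mul_left_comm, ZMod.mul_inv_of_unit _ hu, mul_one]

/-- Chinese remainder theorem, class form: for coprime `L`, `f` the classes `a (mod L)` and `b (mod f)`
intersect in the single class `Nat.chineseRemainder co a b (mod L f)`. [folklore] -/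
theorem natCast_eq_crt_iff {L f : ℕ} (co : L.Coprime f) (a b t : ℕ) :
    (t : ZMod (L * f)) = ((Nat.chineseRemainder co a b : ℕ) : ZMod (L * f)) ↔
      (t : ZMod L) = (a : ZMod L) ∧ t ≡ b [MOD f] := by
  rw [ZMod.natCast_eq_natCast_iff, ZMod.natCast_eq_natCast_iff,
    ← Nat.modEq_and_modEq_iff_modEq_mul co]
  have h1 : (Nat.chineseRemainder co a b : ℕ) ≡ a [MOD L] := (Nat.chineseRemainder co a b).2.1
  have h2 : (Nat.chineseRemainder co a b : ℕ) ≡ b [MOD f] := (Nat.chineseRemainder co a b).2.2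
  exact ⟨fun h => ⟨h.1.trans h1, h.2.trans h2⟩, fun h => ⟨h.1.trans h1.symm, h.2.trans h2.symm⟩⟩

/-- The fibre `{1 ≤ t ≤ M : d t ≡ e (L), t % f = b}` (`b < f`) is the class
`{1 ≤ t ≤ M : t ≡ z_b (mod L f)}`, `z_b = CRT(e d⁻¹ mod L, b mod f)`. [folklore] -/
theorem filter_filter_mod_eq {L : ℕ} [NeZero L] {d : ℕ} (hd : d.Coprime L) (e : ZMod L) {f : ℕ}
    (co : L.Coprime f) {b : ℕ} (hb : b < f) (M : ℕ) :
    ((Icc 1 M).filter (fun t : ℕ => ((d * t : ℕ) : ZMod L) = e)).filter (fun t : ℕ => t % f = b) =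
      (Icc 1 M).filter (fun t : ℕ => (t : ZMod (L * f)) =
        ((Nat.chineseRemainder co (e * (d : ZMod L)⁻¹).val b : ℕ) : ZMod (L * f))) := by
  rw [Finset.filter_filter]
  refine Finset.filter_congr fun t _ => ?_
  rw [natCast_mul_eq_iff hd, natCast_eq_crt_iff]
  refine and_congr_right fun _ => ?_
  unfold Nat.ModEq
  rw [Nat.mod_eq_of_lt hb]

/-! ### One fibre -/

/-- `‖((∑ λ(t) : ℤ) : ℂ)‖ = |∑ λ(t)|` (casts `ℤ → ℂ` and `ℤ → ℝ`). [folklore] -/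
theorem norm_sum_intCast_liouville (s : Finset ℕ) :
    ‖∑ t ∈ s, ((liouville t : ℤ) : ℂ)‖ = |∑ t ∈ s, (liouville t : ℝ)| := by
  rw [← Int.cast_sum, Complex.norm_intCast, Int.cast_sum]

/-- On a set where `t % f = b` the twisted sum satisfies `‖∑ λ(t) ψ(t)‖ ≤ |∑ λ(t)|`
(`ψ(t) = ψ(b)`, `‖ψ(b)‖ ≤ 1`). [folklore] -/
theorem norm_sum_mul_char_le_of_mod_eq {f : ℕ} (ψ : DirichletCharacter ℂ f) (b : ℕ) (s : Finset ℕ)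
    (hs : ∀ t ∈ s, t % f = b) :
    ‖∑ t ∈ s, ((liouville t : ℤ) : ℂ) * ψ (t : ZMod f)‖ ≤ |∑ t ∈ s, (liouville t : ℝ)| := by
  have hψ : ∀ t ∈ s, ψ (t : ZMod f) = ψ (b : ZMod f) := by
    intro t ht
    rw [← ZMod.natCast_mod t f, hs t ht]
  calc ‖∑ t ∈ s, ((liouville t : ℤ) : ℂ) * ψ (t : ZMod f)‖
      = ‖(∑ t ∈ s, ((liouville t : ℤ) : ℂ)) * ψ (b : ZMod f)‖ := by
        rw [Finset.sum_mul]
        exact congrArg _ (Finset.sum_congr rfl fun t ht => by rw [hψ t ht])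
    _ ≤ ‖∑ t ∈ s, ((liouville t : ℤ) : ℂ)‖ := by
        rw [norm_mul]
        exact mul_le_of_le_one_right (norm_nonneg _) (DirichletCharacter.norm_le_one ψ _)
    _ = |∑ t ∈ s, (liouville t : ℝ)| := norm_sum_intCast_liouville s

/-! ### The expansion -/

/-- **Expanding the twist over classes.**  For `d` a unit mod `L`, `(f, L) = 1` and `ψ` a Dirichlet
character mod `f` there are classes `z_b (mod L f)` (`b < f`) with
`‖∑_{1 ≤ t ≤ M, d t ≡ e (L)} λ(t) ψ(t)‖ ≤ ∑_{b < f} |∑_{1 ≤ t ≤ M, t ≡ z_b (L f)} λ(t)|`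
(`z_b = CRT(e d⁻¹ mod L, b mod f)`, independent of `M`). [this line] -/
theorem norm_classSum_char_le_sum_classes {L : ℕ} (hL : 0 < L) {d : ℕ} (hd : d.Coprime L) (e : ZMod L)
    {f : ℕ} (hf : 0 < f) (hfL : f.Coprime L) (ψ : DirichletCharacter ℂ f) (M : ℕ) :
    ∃ z : ℕ → ℕ,
      ‖∑ t ∈ (Icc 1 M).filter (fun t : ℕ => ((d * t : ℕ) : ZMod L) = e),
          ((liouville t : ℤ) : ℂ) * ψ (t : ZMod f)‖ ≤
        ∑ b ∈ range f,
          |∑ t ∈ (Icc 1 M).filter (fun t : ℕ => (t : ZMod (L * f)) = ((z b : ℕ) : ZMod (L * f))),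
            (liouville t : ℝ)| := by
  haveI : NeZero L := ⟨hL.ne'⟩
  have co : L.Coprime f := hfL.symm
  refine ⟨fun b => (Nat.chineseRemainder co (e * (d : ZMod L)⁻¹).val b : ℕ), ?_⟩
  have hmaps : ∀ t ∈ (Icc 1 M).filter (fun t : ℕ => ((d * t : ℕ) : ZMod L) = e), t % f ∈ range f :=
    fun t _ => mem_range.2 (Nat.mod_lt t hf)
  rw [← Finset.sum_fiberwise_of_maps_to hmaps]
  refine (norm_sum_le _ _).trans (Finset.sum_le_sum fun b hb => ?_)
  rw [← filter_filter_mod_eq hd e co (mem_range.1 hb) M]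
  exact norm_sum_mul_char_le_of_mod_eq ψ b _ fun t ht => (Finset.mem_filter.1 ht).2

end MainTermsAux

/-- Landing anchor of the main-terms chain (classes file); registered stub `mainTermsChain4_anchor`. -/
theorem mainTermsChain4_anchor : True := trivial

end Summit.Parity.GeneralizedHardyLittlewood.Cruxes.TypeI2Dilated.PeelToDrappeau

end
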